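import Literature.Computability.QuantumComplexity.HTCnotUniversality
import Literature.Computability.QuantumComplexity.UnitaryGroupFinTwo
import Literature.MathematicalPhysics.QuantumLattice.GaugeGroupsProofs
import Literature.Computability.Cryptography.QubitRegisterHGateProofs
import Literature.Computability.Cryptography.QubitRegisterTGateProofs
import Mathlib.Topology.Instances.AddCircle.DenseSubgroup
import Mathlib.FieldTheory.Minpoly.IsIntegrallyClosed
import Mathlib.RingTheory.Polynomial.RationalRoot
import Mathlib.Algebra.Polynomial.SpecificDegree
import Mathlib.NumberTheory.Real.Irrational
import Mathlib.Tactic.ComputeDegree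
import HarnessLib

/-!
# `H` and `T` generate a dense subgroup of `U(2)` modulo phase — discharge of
`boykin1999_HT_generatesDenselyModPhase`

Sibling proof file of `Literature/Computability/QuantumComplexity/HTCnotUniversality.lean`: it
discharges the named fact
`Literature.Computability.QuantumComplexity.boykin1999_HT_generatesDenselyModPhase` (D-0014) as
`theorem boykin1999_HT_generatesDenselyModPhase_holds : boykin1999_HT_generatesDenselyModPhase`:
the subgroup of `U(2) = Matrix.unitaryGroup (QReg 1) ℂ` generated by the Hadamard gate `hGate`,
the `π/8` gate `tGate` and the global phases `c • 1` is dense (Boykin–Mor–Pulver–Roychowdhury–Vatan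
1999, §3, first step: "`H` and `σ_z^{1/4}` form a dense set in `SU(2)`", meant modulo phase).
No statement or named fact is introduced or changed; every declaration below is proved.

## Proof route

The proof is NOT the printed one (irrational rotations about two *orthogonal* axes `n₁ ⊥ n₂`
obtained with `H^{±1/2}`, irreducibility of the quartic `x⁴ + x³ + x²/4 + x + 1` (App., Thm. 7.1),
and an Euler-angle decomposition), but an independent matrix-group argument:

1. (`topologicalClosure_closure_htPhaseGen`, on `Fin 2`-indexed matrices.)  Let `Γ = ⟨H, T, phases⟩`
   and `K` its closure.  The element `g = TH ∈ Γ` is unitary, hence unitarily diagonalisable,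
   `V⁻¹ g V = diag(d₀, d₁)`
   (`Literature.MathematicalPhysics.QuantumLattice.exists_unitaryGroup_diagonal_of_commute`).
2. `trace_TH_sq`: `tr(g)² = (1 - 1/√2) det g`, so `μ = d₀/d₁` satisfies `μ + μ⁻¹ = -1 - 1/√2`
   (the same phenomenon as Nielsen–Chuang's `THTH = (TH)²`, a rotation by an angle `θ` with
   `cos(θ/2) = cos²(π/8)`, §4.5.3, eqs. (4.74)–(4.75)).
3. `pow_ne_one_of_add_inv_eq`: `μ` is not a root of unity — otherwise `-1 - 1/√2` would be an
   algebraic integer, but its minimal polynomial over `ℚ` is `X² + 2X + 1/2` (Gauss's lemma via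
   `minpoly.isIntegrallyClosed_eq_field_fractions'`; irreducibility from `√2 ∉ ℚ`).
4. Hence `arg μ / 2π` is irrational and the closed subgroup `{θ | diag(e^{iθ}, 1) ∈ V⁻¹ K V}` of
   `ℝ` contains the dense group `ℤ arg μ + 2πℤ` (`dense_addSubgroupClosure_pair_iff`, Kronecker),
   so `V⁻¹ K V` contains the whole diagonal torus.
5. `P = V⁻¹ H V ∈ V⁻¹ K V` has `P₁₀ ≠ 0` (else `H` would commute with `g`; `H2_mul_TH_ne`) and
   `P₀₀ ≠ 0` (else `H g H⁻¹ = det g · g⁻¹`; `H2_conj_TH_ne`).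
6. Two tori generate `U(2)` (`unitaryGroup_fin_two_eq_top_of_diagU_mem` of
   `UnitaryGroupFinTwo.lean`), so `V⁻¹ K V = U(2)`, so `K = U(2)`.
7. Transport to the library's index type `QReg 1 = (Fin 1 → Bool)` along the reindexing
   homomorphisms `unitaryReindex qRegOneEquiv` / `unitaryReindex qRegOneEquiv.symm` (continuous,
   mutually inverse; `reindex_hGate`, `reindex_tGate`).

## References

* P. O. Boykin, T. Mor, M. Pulver, V. Roychowdhury, F. Vatan, *On universal and fault-tolerant
  quantum computing: a novel basis and a new constructive proof of universality for Shor's basis*,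
  FOCS 1999, 486–494; arXiv:quant-ph/9906054, §3 (first step). [Boykin1999FOCS]
* M. A. Nielsen, I. L. Chuang, *Quantum Computation and Quantum Information*, 10th anniversary
  ed., CUP 2010, §4.5.3, eqs. (4.74)–(4.75) (`THTH` is a rotation by an irrational multiple of
  `2π`), §4.2 Thm. 4.1. [NielsenChuang2010]

## Mathlib / Literature

Used: `dense_addSubgroupClosure_pair_iff` (irrational rotations of the circle),
`minpoly.isIntegrallyClosed_eq_field_fractions'`, `Polynomial.Monic.irreducible_iff_roots_eq_zero_of_degree_le_three`,
`irrational_sqrt_two`, `Complex.exp_int_mul_two_pi_mul_I`, `Subgroup.topologicalClosure`,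
`Matrix.reindex`; from Literature: `exists_unitaryGroup_diagonal_of_commute`,
`diagonal_mem_unitaryGroup_iff`, `mul_conj_of_norm_eq_one` (`GaugeGroupsProofs`),
`hGate_mem_unitaryGroup_holds`, `tGate_mem_unitaryGroup_holds`, and `UnitaryGroupFinTwo`.
-/

noncomputable section

namespace Literature.Computability.QuantumComplexity

open Matrix Complex Polynomial Cryptography

local notation "U2" => Matrix.unitaryGroup (Fin 2) ℂ

/-! ### The number-theoretic input: `-1 - 1/√2` is not an algebraic integer -/

/-- If `μ + μ⁻¹ = -1 - 1/√2` then `μ` is not a root of unity: otherwise `μ`, `μ⁻¹` and hence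
`s = μ + μ⁻¹` would be algebraic integers, so the minimal polynomial of `s` over `ℚ` would have
integer coefficients (Gauss's lemma, `minpoly.isIntegrallyClosed_eq_field_fractions'`); but it is
`X² + 2X + 1/2` (irreducible over `ℚ` because `√2 ∉ ℚ`).  This replaces the quartic
`x⁴ + x³ + x²/4 + x + 1` of Boykin et al. (1999), App., Thm. 7.1. [folklore] -/
theorem pow_ne_one_of_add_inv_eq {μ : ℂ} (hμ : μ + μ⁻¹ = -1 - ((Real.sqrt 2)⁻¹ : ℝ)) {m : ℕ}
    (hm : 0 < m) : μ ^ m ≠ 1 := by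
  intro hpow
  -- `μ` and `s = μ + μ⁻¹` are algebraic integers
  have hint : IsIntegral ℤ μ := by
    refine ⟨X ^ m - 1, monic_X_pow_sub_C (1 : ℤ) hm.ne', ?_⟩
    simp [hpow]
  have hinv : μ⁻¹ = μ ^ (m - 1) := by
    have h : μ ^ (m - 1) * μ = 1 := by rw [← pow_succ, Nat.sub_add_cancel hm, hpow]
    exact (eq_inv_of_mul_eq_one_left h).symm
  have hs : IsIntegral ℤ (-1 - ((Real.sqrt 2)⁻¹ : ℝ) : ℂ) := by
    rw [← hμ, hinv]
    exact hint.add (hint.pow _)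
  -- the minimal polynomial of `s` over `ℚ`
  set s : ℂ := (-1 - ((Real.sqrt 2)⁻¹ : ℝ) : ℂ) with hs_def
  have hr2 : ((Real.sqrt 2)⁻¹ : ℝ) ^ 2 = 1 / 2 := by
    rw [inv_pow, Real.sq_sqrt (by norm_num : (0 : ℝ) ≤ 2), one_div]
  have hr2' : (((Real.sqrt 2)⁻¹ : ℝ) : ℂ) ^ 2 = 1 / 2 := by
    rw [← Complex.ofReal_pow, hr2]
    push_cast
    ring
  set p : ℚ[X] := X ^ 2 + 2 * X + C (1 / 2) with hp_def
  have hpm : p.Monic := by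
    rw [hp_def]
    monicity!
  have hpdeg : p.natDegree = 2 := by
    rw [hp_def]
    compute_degree!
  have hroot : aeval s p = 0 := by
    simp only [hp_def, map_add, map_mul, aeval_X_pow, aeval_X, aeval_C, map_ofNat]
    rw [hs_def]
    have : (algebraMap ℚ ℂ) (1 / 2) = 1 / 2 := by simp
    rw [this]
    linear_combination hr2'
  have hirr : Irreducible p := by
    rw [hpm.irreducible_iff_roots_eq_zero_of_degree_le_three (by omega) (by omega)]
    refine Multiset.eq_zero_of_forall_notMem fun q hq => ?_
    rw [mem_roots hpm.ne_zero, IsRoot.def] at hq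
    simp only [hp_def, eval_add, eval_mul, eval_pow, eval_X, eval_C, eval_ofNat] at hq
    -- `(2(q+1))² = 2`, contradicting the irrationality of `√2`
    have hx : ((2 * (q + 1) : ℚ) : ℝ) ^ 2 = 2 := by
      have h : (2 * (q + 1) : ℚ) ^ 2 = 2 := by linear_combination (4 : ℚ) * hq
      exact_mod_cast h
    apply irrational_sqrt_two.ne_rat |2 * (q + 1)|
    rw [Rat.cast_abs, ← Real.sqrt_sq_eq_abs, hx]
  have hmin : minpoly ℚ s = p := (minpoly.eq_of_irreducible_of_monic hirr hroot hpm).symm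
  -- Gauss: the minimal polynomial over `ℚ` is the one over `ℤ`, so its coefficients are integers
  have key := minpoly.isIntegrallyClosed_eq_field_fractions' ℚ hs
  have hc := congr_arg (fun f : ℚ[X] => f.coeff 0) key
  simp only [hmin, hp_def, coeff_add, coeff_X_pow, coeff_C_zero, coeff_map, coeff_ofNat_mul,
    coeff_X_zero] at hc
  norm_num at hc
  -- `hc : 1/2 = ((minpoly ℤ s).coeff 0 : ℚ)`
  have h2 : (2 : ℚ) * ((minpoly ℤ s).coeff 0 : ℚ) = 1 := by rw [← hc]; norm_num
  have h3 : (2 : ℤ) * (minpoly ℤ s).coeff 0 = 1 := by exact_mod_cast h2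
  omega

/-! ### The gates `H` and `T = σ_z^{1/4}` as `2 × 2` matrices -/

/-- The constant `1/√2` (kept as a named real constant so that casts stay atomic). [folklore] -/
def invSqrtTwo : ℝ := (Real.sqrt 2)⁻¹

/-- `1/√2 > 0`. [folklore] -/
theorem invSqrtTwo_pos : 0 < invSqrtTwo := by
  unfold invSqrtTwo
  positivity

/-- `2 · (1/√2)² = 1`. [folklore] -/
theorem two_mul_invSqrtTwo_sq : 2 * invSqrtTwo ^ 2 = 1 := by
  rw [invSqrtTwo, inv_pow, Real.sq_sqrt (by norm_num : (0 : ℝ) ≤ 2)]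
  norm_num

/-- `2 · (1/√2)² = 1` in `ℂ`. [folklore] -/
theorem two_mul_invSqrtTwo_sq' : 2 * (invSqrtTwo : ℂ) ^ 2 = 1 := by
  exact_mod_cast two_mul_invSqrtTwo_sq

/-- `1 / √2 = invSqrtTwo` in `ℂ` (the form of the entries of `hGate`). [folklore] -/
theorem one_div_sqrt_two : (1 / (Real.sqrt 2 : ℂ)) = (invSqrtTwo : ℂ) := by
  rw [invSqrtTwo, Complex.ofReal_inv, one_div]

/-- `(√2)⁻¹ = invSqrtTwo` in `ℂ` (the `simp`-normal form of the entries of `hGate`). [folklore] -/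
theorem sqrt_two_inv : ((Real.sqrt 2 : ℂ))⁻¹ = (invSqrtTwo : ℂ) := by
  rw [invSqrtTwo, Complex.ofReal_inv]

/-- `e^{iπ/4} = (1 + i)/√2`. [folklore] -/
theorem exp_pi_div_four_mul_I : cexp (Real.pi / 4 * I) = (invSqrtTwo : ℂ) * (1 + I) := by
  have h : (Real.pi : ℂ) / 4 * I = ((Real.pi / 4 : ℝ) : ℂ) * I := by push_cast; ring
  rw [h, Complex.exp_mul_I, ← Complex.ofReal_cos, ← Complex.ofReal_sin, Real.cos_pi_div_four,
    Real.sin_pi_div_four, Real.sqrt_div_self]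
  rw [invSqrtTwo]
  ring

/-- The Hadamard gate as a matrix indexed by `Fin 2` (entries `±1/√2`). [folklore] -/
def H2 : Matrix (Fin 2) (Fin 2) ℂ :=
  !![(invSqrtTwo : ℂ), (invSqrtTwo : ℂ); (invSqrtTwo : ℂ), -(invSqrtTwo : ℂ)]

/-- The `π/8` gate `T = diag(1, e^{iπ/4})` as a matrix indexed by `Fin 2`. [folklore] -/
def T2 : Matrix (Fin 2) (Fin 2) ℂ :=
  !![1, 0; 0, cexp (Real.pi / 4 * I)]

/-- `H` is unitary. [folklore] -/
theorem H2_mem : H2 ∈ U2 := by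
  rw [Matrix.mem_unitaryGroup_iff]
  unfold H2
  rw [star_fin_two, Matrix.mul_fin_two, Matrix.one_fin_two]
  simp only [Complex.conj_ofReal, map_neg]
  have h := two_mul_invSqrtTwo_sq'
  ext i j
  fin_cases i <;> fin_cases j <;> simp <;> first | ring1 | linear_combination h

/-- `T` is unitary. [folklore] -/
theorem T2_mem : T2 ∈ U2 := by
  rw [Matrix.mem_unitaryGroup_iff]
  unfold T2
  rw [star_fin_two, Matrix.mul_fin_two, Matrix.one_fin_two]
  have h : (Real.pi : ℂ) / 4 * I = ((Real.pi / 4 : ℝ) : ℂ) * I := by push_cast; ring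
  simp only [map_one, map_zero, mul_zero, zero_mul, add_zero, zero_add, mul_one, h,
    exp_ofReal_mul_I_mul_conj]

/-- A global phase `c • 1` with `‖c‖ = 1` is unitary. [folklore] -/
theorem phase_mem_unitaryGroup {c : ℂ} (hc : ‖c‖ = 1) : c • (1 : Matrix (Fin 2) (Fin 2) ℂ) ∈ U2 := by
  rw [Matrix.mem_unitaryGroup_iff, star_smul, star_one, Matrix.smul_mul, Matrix.one_mul, smul_smul,
    Complex.star_def, Complex.mul_conj, Complex.normSq_eq_norm_sq, hc]
  simp

/-! ### The element `g = T H`: trace, determinant, and two non-relations -/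

/-- `tr(TH)² = (1 - 1/√2) · det(TH)`; equivalently the eigenvalue ratio `μ` of `TH` satisfies
`μ + μ⁻¹ = tr²/det - 2 = -1 - 1/√2`. (The same irrational-angle phenomenon as for
Nielsen–Chuang's `THTH = (TH)²`, eqs. (4.75)–(4.76).) [folklore] -/
theorem trace_TH_sq :
    (T2 * H2).trace ^ 2 = (1 - (invSqrtTwo : ℂ)) * (T2 * H2).det := by
  unfold T2 H2
  rw [Matrix.mul_fin_two, Matrix.trace_fin_two, Matrix.det_fin_two, exp_pi_div_four_mul_I]
  simp
  linear_combination (-(invSqrtTwo : ℂ) ^ 2) * two_mul_invSqrtTwo_sq' +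
    (invSqrtTwo : ℂ) ^ 4 * Complex.I_sq

/-- `H` does not commute with `TH`. [folklore] -/
theorem H2_mul_TH_ne : H2 * (T2 * H2) ≠ T2 * H2 * H2 := by
  intro h
  have h01 := congr_fun (congr_fun h 0) 1
  unfold T2 H2 at h01
  rw [exp_pi_div_four_mul_I] at h01
  simp [Matrix.mul_apply, Fin.sum_univ_two] at h01
  have him := congrArg Complex.im h01
  simp at him
  nlinarith [invSqrtTwo_pos, him, two_mul_invSqrtTwo_sq]

/-- `H (TH) H† ≠ det(TH) · (TH)†`, i.e. conjugation by `H` does not invert `TH` up to the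
determinant phase (it does not swap the two eigenlines of `TH`). [folklore] -/
theorem H2_conj_TH_ne : H2 * (T2 * H2) * star H2 ≠ (T2 * H2).det • star (T2 * H2) := by
  intro h
  have h00 := congr_fun (congr_fun h 0) 0
  unfold T2 H2 at h00
  rw [Matrix.mul_fin_two, Matrix.det_fin_two, exp_pi_div_four_mul_I] at h00
  simp only [star_fin_two] at h00
  simp [Matrix.mul_apply, Fin.sum_univ_two] at h00
  have hre := congrArg Complex.re h00
  have him := congrArg Complex.im h00
  simp at hre him
  nlinarith [invSqrtTwo_pos, hre, him, two_mul_invSqrtTwo_sq]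

/-! ### Reindexing unitary groups along an equivalence of index types -/

section reindex

variable {m n : Type*} [Fintype m] [DecidableEq m] [Fintype n] [DecidableEq n]

/-- Reindexing a unitary matrix along an equivalence of index types gives a unitary matrix.
[folklore] -/
theorem reindex_mem_unitaryGroup (e : m ≃ n) {A : Matrix m m ℂ} (hA : A ∈ Matrix.unitaryGroup m ℂ) :
    Matrix.reindex e e A ∈ Matrix.unitaryGroup n ℂ := by
  rw [Matrix.mem_unitaryGroup_iff] at hA ⊢
  rw [Matrix.reindex_apply, Matrix.star_eq_conjTranspose, Matrix.conjTranspose_submatrix,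
    ← Matrix.star_eq_conjTranspose, Matrix.submatrix_mul_equiv, hA, Matrix.submatrix_one_equiv]

/-- Reindexing as a homomorphism of unitary groups `U(m) → U(n)` along `e : m ≃ n`. [folklore] -/
def unitaryReindex (e : m ≃ n) : Matrix.unitaryGroup m ℂ →* Matrix.unitaryGroup n ℂ where
  toFun A := ⟨Matrix.reindex e e (A : Matrix m m ℂ), reindex_mem_unitaryGroup e A.2⟩
  map_one' := Subtype.ext (by simp [Matrix.reindex_apply, Matrix.submatrix_one_equiv])
  map_mul' A B := Subtype.ext (by
    simp only [Submonoid.coe_mul, Matrix.reindex_apply]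
    exact (Matrix.submatrix_mul_equiv (A : Matrix m m ℂ) (B : Matrix m m ℂ) _ e.symm _).symm)

/-- The matrix of `unitaryReindex e A` is `reindex e e A`. [folklore] -/
@[simp] theorem coe_unitaryReindex (e : m ≃ n) (A : Matrix.unitaryGroup m ℂ) :
    ((unitaryReindex e A : Matrix.unitaryGroup n ℂ) : Matrix n n ℂ) =
      Matrix.reindex e e (A : Matrix m m ℂ) := rfl

/-- `unitaryReindex e` is continuous. [folklore] -/
theorem continuous_unitaryReindex (e : m ≃ n) : Continuous (unitaryReindex (m := m) (n := n) e) :=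
  Continuous.subtype_mk (Continuous.matrix_submatrix continuous_subtype_val _ _) _

/-- `unitaryReindex e.symm` is a left inverse of `unitaryReindex e`. [folklore] -/
theorem unitaryReindex_symm_apply (e : m ≃ n) (A : Matrix.unitaryGroup m ℂ) :
    unitaryReindex e.symm (unitaryReindex e A) = A :=
  Subtype.ext (by simp)

omit [Fintype m] [Fintype n] in
/-- Reindexing a scalar matrix gives the same scalar matrix. [folklore] -/
theorem reindex_smul_one (e : m ≃ n) (c : ℂ) :
    Matrix.reindex e e (c • (1 : Matrix m m ℂ)) = c • (1 : Matrix n n ℂ) := by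
  ext i j
  simp [Matrix.reindex_apply, Matrix.submatrix_apply, Matrix.one_apply]

end reindex

/-! ### Density of `⟨H, T, phases⟩` in `U(2)` (matrices indexed by `Fin 2`) -/

/-- The generators on `Fin 2`: `H`, `T` and the global phases. [folklore] -/
def htPhaseGen : Set U2 :=
  {U | (U : Matrix (Fin 2) (Fin 2) ℂ) ∈ ({H2, T2} : Set (Matrix (Fin 2) (Fin 2) ℂ)) ∨
    ∃ c : ℂ, (U : Matrix (Fin 2) (Fin 2) ℂ) = c • (1 : Matrix (Fin 2) (Fin 2) ℂ)}

/-- A global phase is central in `U(2)`. [folklore] -/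
theorem conj_phase {c : ℂ} (hc : ‖c‖ = 1) (W : U2) :
    W * ⟨c • 1, phase_mem_unitaryGroup hc⟩ * W⁻¹ = ⟨c • 1, phase_mem_unitaryGroup hc⟩ :=
  Subtype.ext (by
    rw [Submonoid.coe_mul, Submonoid.coe_mul, Matrix.UnitaryGroup.inv_apply]
    change (W : Matrix (Fin 2) (Fin 2) ℂ) * (c • 1) * star (W : Matrix (Fin 2) (Fin 2) ℂ) = c • 1
    rw [Matrix.mul_smul, Matrix.mul_one, Matrix.smul_mul, Unitary.mul_star_self_of_mem W.2])

/-- **Main theorem (matrix form on `Fin 2`).** The closure `K` of the subgroup of `U(2)` generated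
by `H`, `T` and the phases is all of `U(2)`.  Route: `g = TH ∈ Γ` is unitarily diagonalised,
`V⁻¹ g V = diag(d₀, d₁)`; the ratio `μ = d₀/d₁` has `μ + μ⁻¹ = tr(g)²/det(g) - 2 = -1 - 1/√2`,
so `μ` is not a root of unity (`pow_ne_one_of_add_inv_eq`); hence the closed subgroup
`{θ | diag(e^{iθ}, 1) ∈ V⁻¹ K V}` of `ℝ` contains the dense group `ℤ arg μ + 2πℤ`
(`dense_addSubgroupClosure_pair_iff`), so `V⁻¹ K V` contains the diagonal torus; it also contains
`P = V⁻¹ H V`, which neither commutes with `diag(d)` (`H2_mul_TH_ne`) nor swaps its eigenlines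
(`H2_conj_TH_ne`), so `P₀₀ ≠ 0 ≠ P₁₀`; by `unitaryGroup_fin_two_eq_top_of_diagU_mem`,
`V⁻¹ K V = U(2)`. [folklore] -/
theorem topologicalClosure_closure_htPhaseGen :
    (Subgroup.closure htPhaseGen).topologicalClosure = ⊤ := by
  set Γ : Subgroup U2 := Subgroup.closure htPhaseGen with hΓ
  set K : Subgroup U2 := Γ.topologicalClosure with hK
  have hKc : IsClosed (K : Set U2) := Subgroup.isClosed_topologicalClosure Γ
  have hΓK : Γ ≤ K := Subgroup.le_topologicalClosure Γ
  -- the generators as group elements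
  set HU : U2 := ⟨H2, H2_mem⟩ with hHU
  set TU : U2 := ⟨T2, T2_mem⟩ with hTU
  have hHΓ : HU ∈ Γ := Subgroup.subset_closure (Or.inl (by simp [hHU]))
  have hTΓ : TU ∈ Γ := Subgroup.subset_closure (Or.inl (by simp [hTU]))
  have hcΓ : ∀ (c : ℂ) (hc : ‖c‖ = 1), (⟨c • 1, phase_mem_unitaryGroup hc⟩ : U2) ∈ Γ := fun c hc =>
    Subgroup.subset_closure (Or.inr ⟨c, rfl⟩)
  -- `g = T H` and its diagonalisation `V⁻¹ g V = diag d`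
  set gU : U2 := TU * HU with hgU
  have hgΓ : gU ∈ Γ := Γ.mul_mem hTΓ hHΓ
  have hgmem : T2 * H2 ∈ U2 := gU.2
  obtain ⟨V, hV, d, hVd⟩ :=
    Literature.MathematicalPhysics.QuantumLattice.exists_unitaryGroup_diagonal_of_commute (T2 * H2) (by
      rw [← Matrix.star_eq_conjTranspose, Unitary.mul_star_self_of_mem hgmem,
        Unitary.star_mul_self_of_mem hgmem])
  have hVV : V * star V = 1 := Unitary.mul_star_self_of_mem hV
  have hSVd : star V * (T2 * H2) * V = diagonal d := by
    rw [mul_assoc, hVd, ← mul_assoc, Unitary.star_mul_self_of_mem hV, one_mul]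
  set VU : U2 := ⟨V, hV⟩ with hVU
  set D : U2 := VU⁻¹ * gU * VU with hDdef
  have hDcoe : (D : Matrix (Fin 2) (Fin 2) ℂ) = diagonal d := by
    rw [hDdef, Submonoid.coe_mul, Submonoid.coe_mul, Matrix.UnitaryGroup.inv_apply]
    exact hSVd
  have hd : ∀ i, ‖d i‖ = 1 :=
    (Literature.MathematicalPhysics.QuantumLattice.diagonal_mem_unitaryGroup_iff d).1 (hDcoe ▸ D.2)
  have hd0 : d 0 ≠ 0 := fun h => by simpa [h] using hd 0
  have hd1 : d 1 ≠ 0 := fun h => by simpa [h] using hd 1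
  -- trace and determinant of `g` in terms of `d`
  have htr : d 0 + d 1 = (T2 * H2).trace := by
    have h1 : (diagonal d).trace = (star V * (T2 * H2) * V).trace := by rw [hSVd]
    rw [Matrix.trace_mul_cycle, hVV, one_mul, Matrix.diagonal_fin_two, Matrix.trace_fin_two] at h1
    simpa using h1
  have hdet : d 0 * d 1 = (T2 * H2).det := by
    have h1 : (diagonal d).det = (star V * (T2 * H2) * V).det := by rw [hSVd]
    rw [det_diagonal, Fin.prod_univ_two, det_mul, det_mul] at h1
    have h2 : (star V).det * V.det = 1 := by
      rw [← det_mul, Unitary.star_mul_self_of_mem hV, det_one]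
    rw [h1]
    linear_combination (T2 * H2).det * h2
  -- the eigenvalue ratio `μ`
  set μ : ℂ := d 0 / d 1 with hμdef
  have hμ : μ + μ⁻¹ = -1 - (invSqrtTwo : ℂ) := by
    have key : (d 0 + d 1) ^ 2 = (1 - (invSqrtTwo : ℂ)) * (d 0 * d 1) := by
      rw [htr, hdet]
      exact trace_TH_sq
    rw [hμdef, inv_div, div_add_div _ _ hd1 hd0, div_eq_iff (mul_ne_zero hd1 hd0)]
    linear_combination key
  have hμnorm : ‖μ‖ = 1 := by rw [hμdef, norm_div, hd 0, hd 1, div_one]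
  have hμexp : cexp (arg μ * I) = μ := exp_arg_mul_I_of_norm_eq_one hμnorm
  have hμpow : ∀ m : ℕ, 0 < m → μ ^ m ≠ 1 := fun m hm => pow_ne_one_of_add_inv_eq hμ hm
  -- the conjugated closed subgroup `K' = V⁻¹ K V`
  set K' : Subgroup U2 := K.comap (MulAut.conj VU).toMonoidHom with hK'
  have memK' : ∀ U : U2, U ∈ K' ↔ VU * U * VU⁻¹ ∈ K := fun U => by
    rw [hK', Subgroup.mem_comap]
    rfl
  have hK'c : IsClosed (K' : Set U2) := by
    have hcont : Continuous fun U : U2 => VU * U * VU⁻¹ := by fun_prop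
    have hset : (K' : Set U2) = (fun U : U2 => VU * U * VU⁻¹) ⁻¹' (K : Set U2) := by
      ext U
      exact memK' U
    rw [hset]
    exact hKc.preimage hcont
  have hDK' : D ∈ K' := by
    rw [memK', hDdef, (by group : VU * (VU⁻¹ * gU * VU) * VU⁻¹ = gU)]
    exact hΓK hgΓ
  have hcK' : ∀ (c : ℂ) (hc : ‖c‖ = 1), (⟨c • 1, phase_mem_unitaryGroup hc⟩ : U2) ∈ K' := by
    intro c hc
    rw [memK', conj_phase hc]
    exact hΓK (hcΓ c hc)
  -- `diag(μ, 1) = d₁⁻¹ • diag(d) ∈ K'`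
  have hθ₀ : diagU (arg μ) 0 ∈ K' := by
    have hc1 : ‖(d 1)⁻¹‖ = 1 := by rw [norm_inv, hd 1, inv_one]
    have heq : diagU (arg μ) 0 = ⟨(d 1)⁻¹ • 1, phase_mem_unitaryGroup hc1⟩ * D := Subtype.ext (by
      rw [coe_diagU, Submonoid.coe_mul, hDcoe]
      change diagMatrix (arg μ) 0 = (d 1)⁻¹ • (1 : Matrix (Fin 2) (Fin 2) ℂ) * diagonal d
      unfold diagMatrix
      rw [hμexp, Matrix.smul_mul, Matrix.one_mul, Matrix.diagonal_fin_two, hμdef]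
      ext i j
      fin_cases i <;> fin_cases j <;> simp [hd1, div_eq_inv_mul])
    rw [heq]
    exact K'.mul_mem (hcK' _ hc1) hDK'
  -- the closed subgroup `Θ = {θ | diag(e^{iθ}, 1) ∈ K'}` of `ℝ`
  let Θ : AddSubgroup ℝ :=
    { carrier := {θ | diagU θ 0 ∈ K'}
      zero_mem' := by
        change diagU 0 0 ∈ K'
        rw [diagU_zero]
        exact K'.one_mem
      add_mem' := fun {a b} ha hb => by
        change diagU (a + b) 0 ∈ K'
        have h : diagU (a + b) 0 = diagU a 0 * diagU b 0 := by simpa using diagU_add a 0 b 0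
        rw [h]
        exact K'.mul_mem ha hb
      neg_mem' := fun {a} ha => by
        change diagU (-a) 0 ∈ K'
        have h : diagU (-a) 0 = (diagU a 0)⁻¹ := by simpa using diagU_neg a 0
        rw [h]
        exact K'.inv_mem ha }
  have hΘc : IsClosed (Θ : Set ℝ) := hK'c.preimage (continuous_diagU 0)
  have h2π : (2 * Real.pi) ∈ Θ := by
    change diagU (2 * Real.pi) 0 ∈ K'
    have h : diagU (2 * Real.pi) 0 = 1 := Subtype.ext (by
      rw [coe_diagU]
      change diagMatrix (2 * Real.pi) 0 = 1
      unfold diagMatrix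
      push_cast
      rw [Complex.exp_two_pi_mul_I, zero_mul, Complex.exp_zero, Matrix.one_fin_two])
    rw [h]
    exact K'.one_mem
  have hargμ : arg μ ∈ Θ := hθ₀
  have hirr : Irrational (arg μ / (2 * Real.pi)) := by
    rintro ⟨q, hq⟩
    have hargq : arg μ = 2 * Real.pi * q := by
      have h2π0 : (2 * Real.pi) ≠ 0 := by positivity
      field_simp at hq
      linarith
    have hqd : ((q : ℝ) : ℂ) * (q.den : ℂ) = (q.num : ℂ) := by
      have h : (q : ℝ) * q.den = q.num := by exact_mod_cast Rat.mul_den_eq_num q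
      exact_mod_cast h
    have hpow : μ ^ q.den = 1 := by
      calc μ ^ q.den = cexp (arg μ * I) ^ q.den := by rw [hμexp]
        _ = cexp (q.den * (arg μ * I)) := (Complex.exp_nat_mul _ q.den).symm
        _ = cexp (q.num * (2 * Real.pi * I)) := by
            congr 1
            rw [hargq]
            push_cast
            linear_combination (2 * Real.pi * I : ℂ) * hqd
        _ = 1 := Complex.exp_int_mul_two_pi_mul_I q.num
    exact hμpow q.den q.den_pos hpow
  have hΘd : Dense (Θ : Set ℝ) := by
    have hle : AddSubgroup.closure {arg μ, 2 * Real.pi} ≤ Θ := by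
      rw [AddSubgroup.closure_le]
      intro x hx
      rcases hx with rfl | rfl
      · exact hargμ
      · exact h2π
    exact (dense_addSubgroupClosure_pair_iff.2 hirr).mono hle
  have hΘuniv : (Θ : Set ℝ) = Set.univ := by
    rw [← hΘc.closure_eq]
    exact hΘd.closure_eq
  have hdiag0 : ∀ θ : ℝ, diagU θ 0 ∈ K' := fun θ => by
    have h : θ ∈ (Θ : Set ℝ) := hΘuniv ▸ Set.mem_univ θ
    exact h
  have hdiagK' : ∀ a b : ℝ, diagU a b ∈ K' := by
    intro a b
    have hcb : ‖cexp (b * I)‖ = 1 := Complex.norm_exp_ofReal_mul_I b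
    have heq : diagU a b = ⟨cexp (b * I) • 1, phase_mem_unitaryGroup hcb⟩ * diagU (a - b) 0 := Subtype.ext (by
      rw [Submonoid.coe_mul, coe_diagU, coe_diagU]
      change diagMatrix a b = cexp (b * I) • (1 : Matrix (Fin 2) (Fin 2) ℂ) * diagMatrix (a - b) 0
      rw [← diagMatrix_self, ← diagMatrix_add]
      congr 1 <;> ring)
    rw [heq]
    exact K'.mul_mem (hcK' _ hcb) (hdiag0 _)
  -- `P = V⁻¹ H V ∈ K'` does not normalise the torus
  set PU : U2 := VU⁻¹ * HU * VU with hPUdef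
  have hPK' : PU ∈ K' := by
    rw [memK', hPUdef, (by group : VU * (VU⁻¹ * HU * VU) * VU⁻¹ = HU)]
    exact hΓK hHΓ
  have hHconj : HU = VU * PU * VU⁻¹ := by rw [hPUdef]; group
  have hgconj : gU = VU * D * VU⁻¹ := by rw [hDdef]; group
  clear_value PU D
  have hP10 : (PU : Matrix (Fin 2) (Fin 2) ℂ) 1 0 ≠ 0 := by
    intro h0
    have h01 : (PU : Matrix (Fin 2) (Fin 2) ℂ) 0 1 = 0 := by
      rw [← norm_eq_zero, unitary_fin_two_norm_01 PU.2, h0, norm_zero]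
    -- `P` is diagonal, so it commutes with `D`
    have hcomm : PU * D = D * PU := Subtype.ext (by
      rw [Submonoid.coe_mul, Submonoid.coe_mul, hDcoe, Matrix.eta_fin_two (PU : Matrix (Fin 2) (Fin 2) ℂ),
        h0, h01, Matrix.diagonal_fin_two, Matrix.mul_fin_two, Matrix.mul_fin_two]
      simp [mul_comm])
    have hHg : HU * gU = gU * HU := by
      rw [hHconj, hgconj]
      calc VU * PU * VU⁻¹ * (VU * D * VU⁻¹) = VU * (PU * D) * VU⁻¹ := by group
        _ = VU * (D * PU) * VU⁻¹ := by rw [hcomm]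
        _ = VU * D * VU⁻¹ * (VU * PU * VU⁻¹) := by group
    have h := congrArg (fun U : U2 => (U : Matrix (Fin 2) (Fin 2) ℂ)) hHg
    simp only [Submonoid.coe_mul] at h
    exact H2_mul_TH_ne h
  have hP00 : (PU : Matrix (Fin 2) (Fin 2) ℂ) 0 0 ≠ 0 := by
    intro h0
    have h11 : (PU : Matrix (Fin 2) (Fin 2) ℂ) 1 1 = 0 := by
      rw [← norm_eq_zero, unitary_fin_two_norm_11 PU.2, h0, norm_zero]
    have hc1 : ‖(PU : Matrix (Fin 2) (Fin 2) ℂ) 1 0‖ = 1 := by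
      have h := unitary_fin_two_norm_sq PU.2
      rw [h0, norm_zero] at h
      nlinarith [norm_nonneg ((PU : Matrix (Fin 2) (Fin 2) ℂ) 1 0)]
    have hb1 : ‖(PU : Matrix (Fin 2) (Fin 2) ℂ) 0 1‖ = 1 := by
      rw [unitary_fin_two_norm_01 PU.2, hc1]
    have hdd : ‖d 0 * d 1‖ = 1 := by rw [norm_mul, hd 0, hd 1, mul_one]
    -- `P` is antidiagonal, so it swaps the entries of `D`: `P D P⁻¹ = (d₀ d₁) • D⁻¹`
    have hconj : PU * D * PU⁻¹ = ⟨(d 0 * d 1) • 1, phase_mem_unitaryGroup hdd⟩ * D⁻¹ := Subtype.ext (by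
      rw [Submonoid.coe_mul, Submonoid.coe_mul, Submonoid.coe_mul, Matrix.UnitaryGroup.inv_apply,
        Matrix.UnitaryGroup.inv_apply, hDcoe, Matrix.eta_fin_two (PU : Matrix (Fin 2) (Fin 2) ℂ), h0, h11,
        Matrix.diagonal_fin_two, star_fin_two, star_fin_two, Matrix.mul_fin_two, Matrix.mul_fin_two]
      change _ = (d 0 * d 1) • (1 : Matrix (Fin 2) (Fin 2) ℂ) * _
      rw [Matrix.smul_mul, Matrix.one_mul]
      have eb := Literature.MathematicalPhysics.QuantumLattice.mul_conj_of_norm_eq_one hb1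
      have ec := Literature.MathematicalPhysics.QuantumLattice.mul_conj_of_norm_eq_one hc1
      have e0 := Literature.MathematicalPhysics.QuantumLattice.mul_conj_of_norm_eq_one (hd 0)
      have e1 := Literature.MathematicalPhysics.QuantumLattice.mul_conj_of_norm_eq_one (hd 1)
      ext i j
      fin_cases i <;> fin_cases j <;> simp
      · linear_combination (d 1) * eb - (d 1) * e0
      · linear_combination (d 0) * ec - (d 0) * e1)
    have hrel : HU * gU * HU⁻¹ = ⟨(d 0 * d 1) • 1, phase_mem_unitaryGroup hdd⟩ * gU⁻¹ := by
      rw [hHconj, hgconj]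
      calc VU * PU * VU⁻¹ * (VU * D * VU⁻¹) * (VU * PU * VU⁻¹)⁻¹ = VU * (PU * D * PU⁻¹) * VU⁻¹ := by group
        _ = VU * (⟨(d 0 * d 1) • 1, phase_mem_unitaryGroup hdd⟩ * D⁻¹) * VU⁻¹ := by rw [hconj]
        _ = VU * ⟨(d 0 * d 1) • 1, phase_mem_unitaryGroup hdd⟩ * VU⁻¹ * (VU * D * VU⁻¹)⁻¹ := by group
        _ = ⟨(d 0 * d 1) • 1, phase_mem_unitaryGroup hdd⟩ * (VU * D * VU⁻¹)⁻¹ := by rw [conj_phase hdd]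
    have h := congrArg (fun U : U2 => (U : Matrix (Fin 2) (Fin 2) ℂ)) hrel
    simp only [Submonoid.coe_mul, Matrix.UnitaryGroup.inv_apply] at h
    change H2 * (T2 * H2) * star H2 = (d 0 * d 1) • (1 : Matrix (Fin 2) (Fin 2) ℂ) * star (T2 * H2) at h
    rw [Matrix.smul_mul, Matrix.one_mul, hdet] at h
    exact H2_conj_TH_ne h
  -- two tori generate: `K' = ⊤`, hence `K = ⊤`
  have hK'top : K' = ⊤ := unitaryGroup_fin_two_eq_top_of_diagU_mem K' hdiagK' hPK' hP00 hP10
  rw [eq_top_iff]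
  intro W _
  have hW : VU⁻¹ * W * VU ∈ K' := hK'top ▸ Subgroup.mem_top _
  rw [memK', (by group : VU * (VU⁻¹ * W * VU) * VU⁻¹ = W)] at hW
  exact hW

/-- Density form of `topologicalClosure_closure_htPhaseGen`: the subgroup of `U(2)` generated by
`H`, `T` and the phases is dense. [folklore] -/
theorem dense_closure_htPhaseGen : Dense ((Subgroup.closure htPhaseGen : Subgroup U2) : Set U2) := by
  rw [dense_iff_closure_eq, ← Subgroup.topologicalClosure_coe, topologicalClosure_closure_htPhaseGen,
    Subgroup.coe_top]

/-! ### Transport to `QReg 1` and the discharge -/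

/-- The index equivalence `QReg 1 = (Fin 1 → Bool) ≃ Fin 2`, `|0⟩ ↦ 0`, `|1⟩ ↦ 1`. [folklore] -/
def qRegOneEquiv : QReg 1 ≃ Fin 2 :=
  (Equiv.funUnique (Fin 1) Bool).trans finTwoEquiv.symm

/-- `qRegOneEquiv.symm 0 = |0⟩`. [folklore] -/
@[simp] theorem qRegOneEquiv_symm_zero : qRegOneEquiv.symm 0 = fun _ => false := rfl

/-- `qRegOneEquiv.symm 1 = |1⟩`. [folklore] -/
@[simp] theorem qRegOneEquiv_symm_one : qRegOneEquiv.symm 1 = fun _ => true := rfl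

/-- Reindexed along `qRegOneEquiv`, the library's Hadamard gate `hGate` is `H2`. [folklore] -/
theorem reindex_hGate : Matrix.reindex qRegOneEquiv qRegOneEquiv hGate = H2 := by
  ext i j
  fin_cases i <;> fin_cases j <;>
    simp [Matrix.reindex_apply, hGate, H2, sqrt_two_inv]

/-- Reindexed along `qRegOneEquiv`, the library's `π/8` gate `tGate` is `T2`. [folklore] -/
theorem reindex_tGate : Matrix.reindex qRegOneEquiv qRegOneEquiv tGate = T2 := by
  ext i j
  fin_cases i <;> fin_cases j <;>
    simp [Matrix.reindex_apply, tGate, T2]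
  · exact fun h => absurd (congr_fun h 0) (by simp)
  · exact fun h => absurd (congr_fun h 0) (by simp)

/-- **Discharge of `boykin1999_HT_generatesDenselyModPhase`** (Boykin–Mor–Pulver–Roychowdhury–Vatan
1999, §3, first step: "`H` and `σ_z^{1/4}` form a dense set in `SU(2)`", modulo phase). The
subgroup of `U(QReg 1)` generated by `hGate`, `tGate` and the phases `c • 1` is dense.  Obtained
from the `Fin 2` form `dense_closure_htPhaseGen` by transport along the reindexing homomorphisms
`unitaryReindex qRegOneEquiv` / `unitaryReindex qRegOneEquiv.symm` (continuous, mutually inverse).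
The proof route (diagonalise `TH`, irrationality of its eigenvalue ratio via the non-integrality of
`-1 - 1/√2`, Kronecker density on the torus, and generation of `U(2)` by two tori) is independent
of the printed Euler-angle argument. [cite: Boykin1999FOCS, §3 (first step)] -/
theorem boykin1999_HT_generatesDenselyModPhase_holds : boykin1999_HT_generatesDenselyModPhase := by
  unfold boykin1999_HT_generatesDenselyModPhase GeneratesDenselyModPhase
  set S1 : Set (Matrix.unitaryGroup (QReg 1) ℂ) :=
    {U | U.1 ∈ ({hGate, tGate} : Set (Matrix (QReg 1) (QReg 1) ℂ)) ∨
      ∃ c : ℂ, U.1 = c • (1 : Matrix (QReg 1) (QReg 1) ℂ)} with hS1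
  set ψ := unitaryReindex (m := QReg 1) (n := Fin 2) qRegOneEquiv with hψ
  set ψ' := unitaryReindex (m := Fin 2) (n := QReg 1) qRegOneEquiv.symm with hψ'
  -- the `Fin 2` generators are images of the `QReg 1` generators
  have hgen : htPhaseGen ⊆ ψ '' S1 := by
    rintro U (hU | ⟨c, hc⟩)
    · rcases hU with hH | hT
      · refine ⟨⟨hGate, hGate_mem_unitaryGroup_holds⟩, Or.inl (Or.inl rfl), Subtype.ext ?_⟩
        rw [hψ, coe_unitaryReindex, hH]
        exact reindex_hGate
      · rw [Set.mem_singleton_iff] at hT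
        refine ⟨⟨tGate, tGate_mem_unitaryGroup_holds⟩, Or.inl (Or.inr rfl), Subtype.ext ?_⟩
        rw [hψ, coe_unitaryReindex, hT]
        exact reindex_tGate
    · have hmem : c • (1 : Matrix (QReg 1) (QReg 1) ℂ) ∈ Matrix.unitaryGroup (QReg 1) ℂ := by
        have h := reindex_mem_unitaryGroup qRegOneEquiv.symm U.2
        rwa [hc, reindex_smul_one] at h
      refine ⟨⟨c • 1, hmem⟩, Or.inr ⟨c, rfl⟩, Subtype.ext ?_⟩
      rw [hψ, coe_unitaryReindex, hc]
      exact reindex_smul_one qRegOneEquiv c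
  have hle : Subgroup.closure htPhaseGen ≤ (Subgroup.closure S1).map ψ := by
    rw [MonoidHom.map_closure]
    exact Subgroup.closure_mono hgen
  have hd2 : Dense (((Subgroup.closure S1).map ψ : Subgroup (Matrix.unitaryGroup (Fin 2) ℂ)) :
      Set (Matrix.unitaryGroup (Fin 2) ℂ)) :=
    dense_closure_htPhaseGen.mono hle
  -- pull back along `ψ'`, a continuous left inverse of `ψ`
  have hsurj : Function.Surjective ψ' := fun A => ⟨ψ A, unitaryReindex_symm_apply _ A⟩
  have himage : ψ' '' (((Subgroup.closure S1).map ψ : Subgroup (Matrix.unitaryGroup (Fin 2) ℂ)) :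
      Set (Matrix.unitaryGroup (Fin 2) ℂ)) = (Subgroup.closure S1 : Set (Matrix.unitaryGroup (QReg 1) ℂ)) := by
    ext A
    simp only [Subgroup.coe_map, Set.mem_image, SetLike.mem_coe]
    constructor
    · rintro ⟨B, ⟨A', hA', rfl⟩, rfl⟩
      rw [hψ, hψ', unitaryReindex_symm_apply]
      exact hA'
    · intro hA
      exact ⟨ψ A, ⟨A, hA, rfl⟩, unitaryReindex_symm_apply _ A⟩
  rw [← himage]
  exact hsurj.denseRange.dense_image (continuous_unitaryReindex _) hd2

end Literature.Computability.QuantumComplexity
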